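import Summits.Ventures.HSemireg.WedgeHankelRecurrenceWaringSylvester
import Summits.Ventures.HSemireg.WedgeHankelRecurrenceCompleteIntersectionTop

/-!
# Venture HSemireg — SYLVESTER FOR THE GENERIC CLASS OF EVEN LEVEL: over an ALGEBRAICALLY CLOSED field with `t + 1 ≠ 0` in `K`, **a class `q` on `[0, 2t]` of TOP middle rank `R^{2t}(q) = t + 1`
# is a sum of `t + 1` geometric sequences with distinct nodes, `q_j = Σ_{i ≤ t} A_i λ_i^j` (`j ≤ 2t`), in INFINITELY MANY WAYS** — one for all but finitely many members `f + a·g` of the pencil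
# `Rec_{t+1}(q) = ⟨f, g⟩` (N59), whose `t + 1` simple roots are the nodes — **and `t + 1` is the least number of terms**; with N66 (`2r ≤ N + 1`) the least number of terms is now known for
# every class on every `[0, N]` («a general binary form of degree `2t` has rank `t + 1` and a one-parameter family of decompositions», Sylvester 1851)

HONEST FRAMING. Part of the Lean index of the computation cell `pub-hsemireg` (seat p10 gen 30, Sunday typer «UNIFORM-IN-n»).
LINEAR ALGEBRA OF HANKEL (catalecticant) MATRICES and of polynomials over a field ONLY: no variety, no cohomology theory, no sheaf, no Ext group and no semiregularity map is constructed
here; nothing here says that HC / HC_CM / HC_AV holds; no Literature fact is declared or used.  Custodian versions as in `WedgeHankelSiegelIdeal` (1/3); the dictionary («the variety of sums of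
powers of a general binary form of degree `2t` is `P(Rec_{t+1}) ≅ P¹` minus the finitely many members with a repeated root», Sylvester 1851; Iarrobino–Kanev LNM 1721 §1.3) is QUOTED in
docstrings, never asserted — «infinitely many ways» below is the infinitude of the set of NODE SETS of `(t + 1)`-term representations.

WHAT IS IN THE TREE / CHAINED.  N66 (`WedgeHankelRecurrenceWaringSylvester`): `exists_forall_rootMultiplicity_le_one` (Bertini for a coprime pencil, `(deg f : K) ≠ 0`),
`exists_eq_C_mul_prod_X_sub_C_of_rootMultiplicity_le_one`, `prod_X_sub_C_mem_of_eq_C_mul`; N59 (`WedgeHankelRecurrenceCompleteIntersectionTop`, № 386): `exists_basis_recSpace_top` (`g₁` of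
degree `≤ t`, `g₂` of degree `t + 1` spanning `Rec_{t+1}(q)`), `isCoprime_of_not_mem_top`; N61 (№ 391) `rank_le_of_secSeq_agree`; N23 (№ 176) `exists_secSeq_of_prod_X_sub_C_mem_recSpace`; N19 (№ 174)
`prod_X_sub_C_nodes_ne_zero`.  Mathlib: `Polynomial.natDegree_add_eq_left_of_natDegree_lt`, `Polynomial.leadingCoeff_add_of_degree_lt'`, `Polynomial.roots_C_mul`, `Polynomial.roots_prod`,
`Polynomial.roots_X_sub_C`, `Multiset.bind_singleton`, `Finset.prod_image`, `Set.infinite_of_injOn_mapsTo`.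
THIS FILE (namespace `Summit.Ventures.HSemireg.Wedge.HankelOuter` continued; CHAINED on N66 (N59 in the tree); 0 definitions):
* §613 THE PENCIL (any field): `add_C_mul_mem_recSpace`, `natDegree_add_C_mul_eq`, `leadingCoeff_add_C_mul_eq` (members `f + a·g` with `deg g < deg f = d`: degree `d`, leading coefficient
  `lc(f)`), **`exists_isCoprime_mem_recSpace_top`** (`R^{2t}(q) = t + 1 ⇒` coprime `f, g ∈ Rec_{t+1}(q)`, `deg g ≤ t < deg f = t + 1`, `g ≠ 0`).
* §614 over an ALGEBRAICALLY CLOSED field: **`exists_secSeq_agree_top_of_rootMultiplicity_le_one`** (a member `f + a·g` with simple roots only gives a `(t + 1)`-term representation whose node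
  set is its root set), **`exists_secSeq_agree_top`** (`(t + 1 : K) ≠ 0 ⇒` a `(t + 1)`-term representation EXISTS), **`isLeast_setOf_exists_secSeq_agree_top`** (`t + 1` is the least number
  of terms), **`infinite_setOf_nodes_top`** (THE NODE SETS OF THE `(t + 1)`-TERM REPRESENTATIONS FORM AN INFINITE SET: `a ↦ roots(f + a·g)` is injective on the cofinite set of good
  parameters), and conversely `prod_X_sub_C_mem_recSpace_top_of_secSeq_agree` (EVERY `(t + 1)`-term representation comes from the pencil: its node polynomial is a member).
CAVEAT.  `(t + 1 : K) ≠ 0` (automatic in characteristic `0` or `> t + 1`) is the Wronskian hypothesis of N66's Bertini lemma; nothing is claimed without it.  Nothing Ext-side.  New names only.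
-/

open Module Polynomial
open scoped Matrix Polynomial

namespace Summit.Ventures.HSemireg.Wedge.HankelOuter

open Summit.Ventures.HSemireg.Wedge Summit.Ventures.HSemireg.Wedge.Hankel Summit.Ventures.HSemireg.Wedge.HankelSecant

variable (K : Type*) [Field K] {N : ℕ}

/-! ## §613. The pencil of recurrences of a generic class of even level -/

/-- the members `f + a·g` of a pencil inside `Rec_k(q)` lie in `Rec_k(q)`. -/
theorem add_C_mul_mem_recSpace {k : ℕ} {q : ℕ → K} {f g : K[X]} (hf : f ∈ recSpace K N q k) (hg : g ∈ recSpace K N q k) (a : K) : f + C a * g ∈ recSpace K N q k :=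
  Submodule.add_mem _ hf (by rw [Polynomial.C_mul']; exact Submodule.smul_mem _ a hg)

variable {K}

/-- `deg g < deg f = d ⇒ deg (f + a·g) = d` … -/
theorem natDegree_add_C_mul_eq {f g : K[X]} {d : ℕ} (hfd : f.natDegree = d) (hgd : g.natDegree < d) (a : K) : (f + C a * g).natDegree = d := by
  rw [natDegree_add_eq_left_of_natDegree_lt ((natDegree_C_mul_le a g).trans_lt (by rw [hfd]; exact hgd)), hfd]

/-- … and `lc(f + a·g) = lc(f)`. -/
theorem leadingCoeff_add_C_mul_eq {f g : K[X]} {d : ℕ} (hfd : f.natDegree = d) (hgd : g.natDegree < d) (a : K) : (f + C a * g).leadingCoeff = f.leadingCoeff :=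
  leadingCoeff_add_of_degree_lt' (degree_lt_degree ((natDegree_C_mul_le a g).trans_lt (by rw [hfd]; exact hgd)))

variable (K)

/-- **THE PENCIL OF A GENERIC CLASS: for `R^{2t}(q) = t + 1` there are COPRIME `f, g ∈ Rec_{t+1}(q)` with `deg g ≤ t < deg f = t + 1`, `g ≠ 0`** (N59's basis adapted to `∞` and its coprimality). -/
theorem exists_isCoprime_mem_recSpace_top {t : ℕ} {q : ℕ → K} (hq : (hankel1 K (t + t) ((t + t) / 2) q).rank = t + 1) :
    ∃ f g : K[X], f ∈ recSpace K (t + t) q (t + 1) ∧ g ∈ recSpace K (t + t) q (t + 1) ∧ IsCoprime f g ∧ f.natDegree = t + 1 ∧ g.natDegree ≤ t ∧ g ≠ 0 := by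
  obtain ⟨g₁, g₂, hg₁, hg₁0, hg₁d, hg₂, hg₂d, hg₂A⟩ := exists_basis_recSpace_top K hq
  exact ⟨g₂, g₁, hg₂, hg₁, (isCoprime_of_not_mem_top K hq hg₁ hg₁0 hg₂ hg₂A).symm, hg₂d, hg₁d, hg₁0⟩

/-! ## §614. Over an algebraically closed field: `t + 1` terms, in infinitely many ways, and never fewer -/

/-- **A MEMBER OF THE PENCIL WITH SIMPLE ROOTS GIVES A `(t + 1)`-TERM REPRESENTATION WHOSE NODES ARE ITS ROOTS** (algebraically closed `K`; `R^{2t}(q) = t + 1`, `f, g ∈ Rec_{t+1}(q)`,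
`deg g ≤ t < deg f = t + 1`, every root of `f + a·g` simple): `f + a·g = lc(f)·∏_{i ≤ t} (X − λ_i)` with distinct `λ_i`, `{λ_i} = roots(f + a·g)`, and `q_j = Σ_i A_i λ_i^j` on `[0, 2t]`. -/
theorem exists_secSeq_agree_top_of_rootMultiplicity_le_one [IsAlgClosed K] [DecidableEq K] {t : ℕ} {q : ℕ → K} {f g : K[X]} (hf : f ∈ recSpace K (t + t) q (t + 1)) (hg : g ∈ recSpace K (t + t) q (t + 1))
    (hfd : f.natDegree = t + 1) (hgd : g.natDegree ≤ t) {a : K} (ha : ∀ x, (f + C a * g).rootMultiplicity x ≤ 1) :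
    ∃ (lam A : Fin (t + 1) → K), Function.Injective lam ∧ f + C a * g = C f.leadingCoeff * ∏ i, (Polynomial.X - C (lam i)) ∧
      Finset.univ.image lam = (f + C a * g).roots.toFinset ∧ ∀ j ≤ t + t, q j = secSeq K A lam j := by
  have hpd : (f + C a * g).natDegree = t + 1 := natDegree_add_C_mul_eq hfd (show g.natDegree < t + 1 by omega) a
  have hp0 : f + C a * g ≠ 0 := fun h => by rw [h, natDegree_zero] at hpd; omega
  obtain ⟨lam, hlam, hprod⟩ := exists_eq_C_mul_prod_X_sub_C_of_rootMultiplicity_le_one hpd ha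
  obtain ⟨A, hA⟩ := exists_secSeq_of_prod_X_sub_C_mem_recSpace K hlam (prod_X_sub_C_mem_of_eq_C_mul hp0 hprod (add_C_mul_mem_recSpace K hf hg a))
  have hlc : (f + C a * g).leadingCoeff ≠ 0 := leadingCoeff_ne_zero.mpr hp0
  have hroots : (f + C a * g).roots = (Finset.univ.val : Multiset (Fin (t + 1))).map lam := by
    rw [hprod, roots_C_mul _ hlc, roots_prod _ _ (prod_X_sub_C_nodes_ne_zero K lam)]
    simp_rw [roots_X_sub_C]
    exact Multiset.bind_singleton _ _
  refine ⟨lam, A, hlam, by rw [← leadingCoeff_add_C_mul_eq hfd (show g.natDegree < t + 1 by omega) a]; exact hprod, ?_, hA⟩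
  rw [hroots]
  ext x
  simp only [Finset.mem_image, Finset.mem_univ, true_and, Multiset.mem_toFinset, Multiset.mem_map, Finset.mem_val]

/-- **SYLVESTER FOR THE GENERIC CLASS: over an ALGEBRAICALLY CLOSED field with `(t + 1 : K) ≠ 0`, every `q` with `R^{2t}(q) = t + 1` is a sum of `t + 1` geometric sequences with distinct
nodes on `[0, 2t]`** («a general binary form of degree `2t` has rank `t + 1`»). -/
theorem exists_secSeq_agree_top [IsAlgClosed K] {t : ℕ} {q : ℕ → K} (hq : (hankel1 K (t + t) ((t + t) / 2) q).rank = t + 1) (hchar : ((t + 1 : ℕ) : K) ≠ 0) :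
    ∃ (lam A : Fin (t + 1) → K), Function.Injective lam ∧ ∀ j ≤ t + t, q j = secSeq K A lam j := by
  classical
  obtain ⟨f, g, hf, hg, hcop, hfd, hgd, -⟩ := exists_isCoprime_mem_recSpace_top K hq
  obtain ⟨a, -, ha⟩ := exists_forall_rootMultiplicity_le_one hcop (by rw [hfd]; exact hchar) ∅
  obtain ⟨lam, A, hlam, -, -, hA⟩ := exists_secSeq_agree_top_of_rootMultiplicity_le_one K hf hg hfd hgd ha
  exact ⟨lam, A, hlam, hA⟩

/-- … in characteristic `0` with no further hypothesis. -/
theorem exists_secSeq_agree_top_of_charZero [IsAlgClosed K] [CharZero K] {t : ℕ} {q : ℕ → K} (hq : (hankel1 K (t + t) ((t + t) / 2) q).rank = t + 1) :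
    ∃ (lam A : Fin (t + 1) → K), Function.Injective lam ∧ ∀ j ≤ t + t, q j = secSeq K A lam j :=
  exists_secSeq_agree_top K hq (Nat.cast_ne_zero.mpr (Nat.succ_ne_zero t))

/-- **`t + 1` IS THE LEAST NUMBER OF TERMS for a class of top rank on `[0, 2t]`** (algebraically closed `K`, `(t + 1 : K) ≠ 0`; every representation has at least `R^{2t}(q)` terms, N61). -/
theorem isLeast_setOf_exists_secSeq_agree_top [IsAlgClosed K] {t : ℕ} {q : ℕ → K} (hq : (hankel1 K (t + t) ((t + t) / 2) q).rank = t + 1) (hchar : ((t + 1 : ℕ) : K) ≠ 0) :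
    IsLeast {n : ℕ | ∃ (lam A : Fin n → K), Function.Injective lam ∧ ∀ j ≤ t + t, q j = secSeq K A lam j} (t + 1) :=
  ⟨exists_secSeq_agree_top K hq hchar, fun _ ⟨_, _, hlam, hrep⟩ => hq ▸ rank_le_of_secSeq_agree K hlam hrep⟩

/-- **INFINITELY MANY WAYS: over an ALGEBRAICALLY CLOSED field with `(t + 1 : K) ≠ 0`, the NODE SETS `{λ_0, …, λ_t}` of the `(t + 1)`-term representations of a class of top rank on
`[0, 2t]` form an INFINITE set** — the map `a ↦ roots(f + a·g)` from the cofinite set of good parameters of the pencil is injective (`f + a·g` is recovered as `lc(f)·∏ (X − λ_i)`, and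
`a·g = a′·g ⇒ a = a′`). -/
theorem infinite_setOf_nodes_top [IsAlgClosed K] [DecidableEq K] {t : ℕ} {q : ℕ → K} (hq : (hankel1 K (t + t) ((t + t) / 2) q).rank = t + 1) (hchar : ((t + 1 : ℕ) : K) ≠ 0) :
    {s : Finset K | ∃ (lam A : Fin (t + 1) → K), Function.Injective lam ∧ Finset.univ.image lam = s ∧ ∀ j ≤ t + t, q j = secSeq K A lam j}.Infinite := by
  obtain ⟨f, g, hf, hg, hcop, hfd, hgd, hg0⟩ := exists_isCoprime_mem_recSpace_top K hq
  set D : Set K := {a | ∀ x, (f + C a * g).rootMultiplicity x ≤ 1} with hD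
  have hDinf : D.Infinite := fun hfin => by
    obtain ⟨a, haS, ha⟩ := exists_forall_rootMultiplicity_le_one hcop (by rw [hfd]; exact hchar) hfin.toFinset
    exact haS (hfin.mem_toFinset.mpr ha)
  refine Set.infinite_of_injOn_mapsTo (f := fun a => (f + C a * g).roots.toFinset) (fun a ha a' ha' h => ?_) (fun a ha => ?_) hDinf
  · -- equal root sets ⇒ equal members ⇒ equal parameters
    obtain ⟨lam, -, hlam, hprod, himg, -⟩ := exists_secSeq_agree_top_of_rootMultiplicity_le_one K hf hg hfd hgd ha
    obtain ⟨lam', -, hlam', hprod', himg', -⟩ := exists_secSeq_agree_top_of_rootMultiplicity_le_one K hf hg hfd hgd ha'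
    have hs : Finset.univ.image lam = Finset.univ.image lam' := by rw [himg, himg']; exact h
    have hpp : (∏ i, (Polynomial.X - C (lam i))) = ∏ i, (Polynomial.X - C (lam' i)) :=
      calc (∏ i, (Polynomial.X - C (lam i))) = ∏ x ∈ Finset.univ.image lam, (Polynomial.X - C x) :=
            (Finset.prod_image (f := fun x => Polynomial.X - C x) fun i _ j _ h => hlam h).symm
        _ = ∏ x ∈ Finset.univ.image lam', (Polynomial.X - C x) := by rw [hs]
        _ = ∏ i, (Polynomial.X - C (lam' i)) := Finset.prod_image (f := fun x => Polynomial.X - C x) fun i _ j _ h => hlam' h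
    have heq : f + C a * g = f + C a' * g := by rw [hprod, hprod', hpp]
    exact C_inj.mp (mul_right_cancel₀ hg0 (add_left_cancel heq))
  · obtain ⟨lam, A, hlam, -, himg, hA⟩ := exists_secSeq_agree_top_of_rootMultiplicity_le_one K hf hg hfd hgd ha
    exact ⟨lam, A, hlam, himg, hA⟩

/-- conversely **EVERY `(t + 1)`-TERM REPRESENTATION COMES FROM THE PENCIL: its node polynomial `∏ (X − λ_i)` is a member of `Rec_{t+1}(q)`** (N61, recalled at the top rank; any field). -/
theorem prod_X_sub_C_mem_recSpace_top_of_secSeq_agree {t : ℕ} {q : ℕ → K} {lam A : Fin (t + 1) → K} (hlam : Function.Injective lam) (hrep : ∀ j ≤ t + t, q j = secSeq K A lam j) :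
    (∏ i, (Polynomial.X - C (lam i))) ∈ recSpace K (t + t) q (t + 1) :=
  prod_X_sub_C_mem_recSpace_of_secSeq_agree K hlam hrep

end Summit.Ventures.HSemireg.Wedge.HankelOuter
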